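import Summits.CriticalPhenomena.Ising3DConformalLimit.Theorems.EnergyNotSigmaSquaredMoebiusLimitExistsPedigreeDefs
import Summits.CriticalPhenomena.Ising3DConformalLimit.Theorems.MoebiusLimitExists.Negative.PedigreeCuts
import HarnessLib

/-!
# Mirror pedigrees III: from the combinatorial covering theorem to pedigrees with margins of Euclidean configurations

(Stub `pedigree_cover` of line `only-interaction-breaks-moebius`, crux `MoebiusLimitExists`, item
stmt-CriticalPhenomena-1344, route `EnergyNotSigmaSquared`.)

Given the covering theorem (`Cover.HasPedigree P` for every finite `P ⊂ ℝ³`, moving point `0`),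
every non-coincident configuration `x : Fin n → ℝ³` admits, for every moving index `i`, a mirror
pedigree `PedigreeOK μ d n x i` with SOME positive margin `μ` and depth `d` (`pedigree_cover`).

The combinatorial pedigree of the finite point set `{x j − x i : j}` is transported along the
dictionary `v ↦ (v 0, v 1, v 2)`, integer cubic directions `g ↦ (g 0, g 1, g 2) ∈ Cover.dirs`
(`exists_cubicDir_of_mem_dirs_pc`), `g·` = `Cover.pdot` (`pdot_cast_pc`), translated mirrors
`reflectZ g (T + g·(x i)) y − x i = Cover.prefl g T (y − x i)` (`toPt_reflectZ_sub_pc`), and the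
enumeration of the kept cluster first (`exists_enum_pc`).  The induction over the pedigree
(`cover_main_pc`) only uses that the point set is CONTAINED in a set carrying a pedigree; the margin
is the least distance of a point to the mirror (resp. the least signed coordinate gap at a terminal
node, `Cover.exists_pos_le_all`), and margins are produced for all smaller values at once, so that
the minimum along the pedigree needs no monotonicity lemma.
-/

noncomputable section

open Filter Topology Set Function
open Literature.Probability.LatticeModels
open Summit.CriticalPhenomena.Ising3DConformalLimit.MoebiusLimitExistsNegative.Pedigree

namespace Summit.CriticalPhenomena.Ising3DConformalLimit.MoebiusLimitExistsOnlyInteraction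

/-! ### Dictionary: integer cubic directions, functionals and mirrors versus `Cover` -/

/-- Every direction of `Cover.dirs` is the real image of an integer cubic direction. [folklore] -/
theorem exists_cubicDir_of_mem_dirs_pc {f : Cover.Pt} (hf : f ∈ Cover.dirs) :
    ∃ g : Site 3, IsCubicDir g ∧ (((g 0 : ℤ) : ℝ), ((g 1 : ℤ) : ℝ), ((g 2 : ℤ) : ℝ)) = f := by
  simp only [Cover.dirs, List.mem_cons, List.mem_nil_iff, or_false] at hf
  rcases hf with rfl | rfl | rfl | rfl | rfl | rfl | rfl | rfl | rfl | rfl | rfl | rfl | rfl | rfl |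
    rfl | rfl | rfl | rfl
  · exact ⟨![1, 0, 0], ⟨fun j => by fin_cases j <;> simp, by simp [zdot]⟩, by simp⟩
  · exact ⟨![0, 1, 0], ⟨fun j => by fin_cases j <;> simp, by simp [zdot]⟩, by simp⟩
  · exact ⟨![0, 0, 1], ⟨fun j => by fin_cases j <;> simp, by simp [zdot]⟩, by simp⟩
  · exact ⟨![1, 1, 0], ⟨fun j => by fin_cases j <;> simp, by simp [zdot]⟩, by simp⟩
  · exact ⟨![1, -1, 0], ⟨fun j => by fin_cases j <;> simp, by simp [zdot]⟩, by simp⟩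
  · exact ⟨![1, 0, 1], ⟨fun j => by fin_cases j <;> simp, by simp [zdot]⟩, by simp⟩
  · exact ⟨![1, 0, -1], ⟨fun j => by fin_cases j <;> simp, by simp [zdot]⟩, by simp⟩
  · exact ⟨![0, 1, 1], ⟨fun j => by fin_cases j <;> simp, by simp [zdot]⟩, by simp⟩
  · exact ⟨![0, 1, -1], ⟨fun j => by fin_cases j <;> simp, by simp [zdot]⟩, by simp⟩
  · exact ⟨![-1, 0, 0], ⟨fun j => by fin_cases j <;> simp, by simp [zdot]⟩, by simp⟩
  · exact ⟨![0, -1, 0], ⟨fun j => by fin_cases j <;> simp, by simp [zdot]⟩, by simp⟩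
  · exact ⟨![0, 0, -1], ⟨fun j => by fin_cases j <;> simp, by simp [zdot]⟩, by simp⟩
  · exact ⟨![-1, -1, 0], ⟨fun j => by fin_cases j <;> simp, by simp [zdot]⟩, by simp⟩
  · exact ⟨![-1, 1, 0], ⟨fun j => by fin_cases j <;> simp, by simp [zdot]⟩, by simp⟩
  · exact ⟨![-1, 0, -1], ⟨fun j => by fin_cases j <;> simp, by simp [zdot]⟩, by simp⟩
  · exact ⟨![-1, 0, 1], ⟨fun j => by fin_cases j <;> simp, by simp [zdot]⟩, by simp⟩
  · exact ⟨![0, -1, -1], ⟨fun j => by fin_cases j <;> simp, by simp [zdot]⟩, by simp⟩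
  · exact ⟨![0, -1, 1], ⟨fun j => by fin_cases j <;> simp, by simp [zdot]⟩, by simp⟩

/-- The six coordinate directions `±e_τ` of a terminal node read off a signed coordinate.
[folklore] -/
theorem terminal_dir_pc {g : Cover.Pt}
    (hg : g ∈ [((1:ℝ),(0:ℝ),(0:ℝ)), (0,1,0), (0,0,1), (-1,0,0), (0,-1,0), (0,0,-1)]) :
    ∃ τ : Fin 3, ∃ s : ℝ, (s = 1 ∨ s = -1) ∧
      ∀ v : EuclideanSpace ℝ (Fin 3), Cover.pdot g (v 0, v 1, v 2) = s * v τ := by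
  simp only [List.mem_cons, List.mem_nil_iff, or_false] at hg
  rcases hg with rfl | rfl | rfl | rfl | rfl | rfl
  · exact ⟨0, 1, Or.inl rfl, fun v => by simp [Cover.pdot]⟩
  · exact ⟨1, 1, Or.inl rfl, fun v => by simp [Cover.pdot]⟩
  · exact ⟨2, 1, Or.inl rfl, fun v => by simp [Cover.pdot]⟩
  · exact ⟨0, -1, Or.inr rfl, fun v => by simp [Cover.pdot]⟩
  · exact ⟨1, -1, Or.inr rfl, fun v => by simp [Cover.pdot]⟩
  · exact ⟨2, -1, Or.inr rfl, fun v => by simp [Cover.pdot]⟩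

/-- The integer functional `rdotZ g` is the combinatorial dot product with `(g 0, g 1, g 2)` in
coordinates. [folklore] -/
theorem pdot_cast_pc (g : Site 3) (v : EuclideanSpace ℝ (Fin 3)) :
    Cover.pdot (((g 0 : ℤ) : ℝ), ((g 1 : ℤ) : ℝ), ((g 2 : ℤ) : ℝ)) (v 0, v 1, v 2) = rdotZ g v :=
  rfl

/-- Additivity of the integer functional. [folklore] -/
theorem rdotZ_sub_pc (g : Site 3) (v w : EuclideanSpace ℝ (Fin 3)) :
    rdotZ g (v - w) = rdotZ g v - rdotZ g w := by
  simp only [rdotZ, PiLp.sub_apply]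
  ring

/-- Translated mirrors: reflecting `y` in `{g· = T + g·w}` and subtracting `w` is reflecting
`y − w` in `{g· = T}`, in the coordinates of `Cover.prefl`. [folklore] -/
theorem toPt_reflectZ_sub_pc (g : Site 3) (T T' : ℝ) (y w : EuclideanSpace ℝ (Fin 3))
    (hT' : T' = T + rdotZ g w) :
    (((reflectZ g T' y - w) 0 : ℝ), (reflectZ g T' y - w) 1, (reflectZ g T' y - w) 2) =
      Cover.prefl (((g 0 : ℤ) : ℝ), ((g 1 : ℤ) : ℝ), ((g 2 : ℤ) : ℝ)) T
        ((y - w) 0, (y - w) 1, (y - w) 2) := by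
  subst hT'
  simp only [Cover.prefl, Cover.pdot, PiLp.sub_apply, reflectZ_apply, rdotZ, zdot, Prod.mk.injEq]
  push_cast
  refine ⟨?_, ?_, ?_⟩ <;> ring

/-- `(v 0, v 1, v 2) = 0` only for `v = 0`. [folklore] -/
theorem eq_zero_of_toPt_pc {v : EuclideanSpace ℝ (Fin 3)} (h : ((v 0 : ℝ), v 1, v 2) = 0) :
    v = 0 := by
  simp only [Prod.mk_eq_zero] at h
  ext k
  fin_cases k
  · simpa using h.1
  · simpa using h.2.1
  · simpa using h.2.2

/-! ### Enumerations putting a cluster first -/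

/-- Enumeration of `Fin n` putting a finset `A ∋ i` first: `e : Fin (a + b) ≃ Fin n` with the
first block into `A`, the second block into the complement, and `i` in the first block.
[folklore] -/
theorem exists_enum_pc {n : ℕ} (A : Finset (Fin n)) {i : Fin n} (hi : i ∈ A) :
    ∃ (a b : ℕ) (e : Fin (a + b) ≃ Fin n) (i₀ : Fin a), e (Fin.castAdd b i₀) = i ∧
      (∀ j : Fin a, e (Fin.castAdd b j) ∈ A) ∧ (∀ j : Fin b, e (Fin.natAdd a j) ∉ A) := by
  classical
  let eA : Fin (Fintype.card {j // j ∈ A}) ≃ {j // j ∈ A} := (Fintype.equivFin _).symm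
  let eB : Fin (Fintype.card {j // j ∉ A}) ≃ {j // j ∉ A} := (Fintype.equivFin _).symm
  let e : Fin (Fintype.card {j // j ∈ A} + Fintype.card {j // j ∉ A}) ≃ Fin n :=
    finSumFinEquiv.symm.trans ((eA.sumCongr eB).trans (Equiv.sumCompl fun j => j ∈ A))
  refine ⟨_, _, e, eA.symm ⟨i, hi⟩, ?_, fun j => ?_, fun j => ?_⟩
  · simp [e]
  · simp only [e, Equiv.trans_apply, finSumFinEquiv_symm_apply_castAdd, Equiv.sumCongr_apply,
      Sum.map_inl, Equiv.sumCompl_apply_inl]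
    exact (eA j).2
  · simp only [e, Equiv.trans_apply, finSumFinEquiv_symm_apply_natAdd, Equiv.sumCongr_apply,
      Sum.map_inr, Equiv.sumCompl_apply_inr]
    exact (eB j).2

/-! ### Transport of a combinatorial pedigree -/

/-- **Transport.** If a finite `P ⊂ ℝ³` carrying a mirror pedigree (moving point `0`) contains all
the differences `x j − x i` of a configuration `x` whose moving point `x i` is distinct from the
other points, then `x` admits, for every small enough margin `μ`, a pedigree `PedigreeOK μ d n x i`
of some depth. Terminal node `±e_τ`: the margin is the least signed coordinate gap; cut `(f, T)`,
`f = (g 0, g 1, g 2)`: the Euclidean cut is `(g, T + g·(x i))` with the kept cluster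
`{g·(x j) < T + g·(x i)} ∋ i` enumerated first, its margin the least distance to the mirror, and the
doubled configuration's differences lie in `Cover.pcut f T P`. [folklore] -/
theorem cover_main_pc {P : Finset Cover.Pt} (hP : Cover.HasPedigree P) :
    ∀ (n : ℕ) (x : Fin n → EuclideanSpace ℝ (Fin 3)) (i : Fin n), (∀ j, j ≠ i → x j ≠ x i) →
      (∀ j, (((x j - x i) 0 : ℝ), (x j - x i) 1, (x j - x i) 2) ∈ P) →
      ∃ μ₀ : ℝ, 0 < μ₀ ∧ ∀ μ, μ ≤ μ₀ → ∃ d : ℕ, PedigreeOK μ d n x i := by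
  induction hP with
  | @terminal P g hg h =>
    intro n x i hdist hmem
    obtain ⟨τ, s, hs, hpd⟩ := terminal_dir_pc hg
    obtain ⟨m, hm, hmin⟩ := Cover.exists_pos_le_all P (Cover.pdot g)
    have key : ∀ j, j ≠ i → m ≤ s * (x j τ - x i τ) := fun j hj => by
      have hne : (((x j - x i) 0 : ℝ), (x j - x i) 1, (x j - x i) 2) ≠ 0 := fun h0 =>
        hdist j hj (sub_eq_zero.1 (eq_zero_of_toPt_pc h0))
      have h1 := hmin _ (hmem j) (h _ (hmem j) hne)
      rw [hpd, PiLp.sub_apply] at h1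
      exact h1
    refine ⟨m, hm, fun μ hμ => ⟨0, (pedigreeOK_zero μ x i).2 ⟨τ, ?_⟩⟩⟩
    rcases hs with rfl | rfl
    · exact Or.inl fun j hj => by have := key j hj; linarith
    · exact Or.inr fun j hj => by have := key j hj; linarith
  | @cut P f T hf hT hoff _ ih =>
    intro n x i hdist hmem
    obtain ⟨g, hg, rfl⟩ := exists_cubicDir_of_mem_dirs_pc hf
    obtain ⟨T', hT'⟩ : ∃ T' : ℝ, T' = T + rdotZ g (x i) := ⟨_, rfl⟩
    have hiT : rdotZ g (x i) < T' := by linarith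
    classical
    obtain ⟨A, hA⟩ : ∃ A : Finset (Fin n), ∀ j, j ∈ A ↔ rdotZ g (x j) < T' :=
      ⟨Finset.univ.filter fun j => rdotZ g (x j) < T', fun j => by simp⟩
    obtain ⟨a, b, e, i₀, hei, heA, heB⟩ := exists_enum_pc A ((hA i).2 hiT)
    have hlow : ∀ j : Fin a, rdotZ g (x (e (Fin.castAdd b j))) < T' := fun j => (hA _).1 (heA j)
    have hhigh : ∀ j : Fin b, T' ≤ rdotZ g (x (e (Fin.natAdd a j))) := fun j =>
      not_lt.1 fun h' => heB j ((hA _).2 h')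
    -- the least distance of a point to the mirror
    obtain ⟨m, hm, hmin⟩ := Cover.exists_pos_le_all P
      (fun q => |Cover.pdot (((g 0 : ℤ) : ℝ), ((g 1 : ℤ) : ℝ), ((g 2 : ℤ) : ℝ)) q - T|)
    have hgap : ∀ j, m ≤ |rdotZ g (x j) - T'| := fun j => by
      have h0 : Cover.pdot (((g 0 : ℤ) : ℝ), ((g 1 : ℤ) : ℝ), ((g 2 : ℤ) : ℝ))
          (((x j - x i) 0 : ℝ), (x j - x i) 1, (x j - x i) 2) - T = rdotZ g (x j) - T' := by
        rw [pdot_cast_pc, rdotZ_sub_pc, hT']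
        ring
      have h1 := hmin _ (hmem j) (abs_pos.2 (sub_ne_zero.2 (hoff _ (hmem j))))
      dsimp only at h1
      rwa [h0] at h1
    -- the doubled configuration: moving point, distinctness, differences in the cut
    have hctr : doubledA g T' (x ∘ ⇑e) (Fin.castAdd a i₀) = x i := by
      rw [doubledA_left, Function.comp_apply, hei]
    have hdist' : ∀ j', j' ≠ Fin.castAdd a i₀ →
        doubledA g T' (x ∘ ⇑e) j' ≠ doubledA g T' (x ∘ ⇑e) (Fin.castAdd a i₀) := by
      intro j' hj'
      rw [hctr]
      induction j' using Fin.addCases with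
      | left j =>
        rw [doubledA_left, Function.comp_apply]
        refine hdist _ fun h' => hj' ?_
        rw [← hei] at h'
        rw [Fin.castAdd_injective _ _ (e.injective h')]
      | right j =>
        rw [doubledA_right, Function.comp_apply]
        intro h'
        -- the mirror reverses the functional (cf. `rdotZ_reflectZ_dt` of `…DoubledThickening`)
        have hz : (zdot g g : ℝ) ≠ 0 := by
          rcases hg.2 with h0 | h0 <;> simp [h0]
        have h2 : rdotZ g (x i) = rdotZ g (x (e (Fin.castAdd b j))) -
            2 * (rdotZ g (x (e (Fin.castAdd b j))) - T') / (zdot g g : ℝ) * (zdot g g : ℝ) := by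
          rw [← h']
          simp only [rdotZ, reflectZ_apply, zdot]
          push_cast
          ring
        rw [div_mul_cancel₀ _ hz] at h2
        linarith [hlow j]
    have hmem' : ∀ j',
        (((doubledA g T' (x ∘ ⇑e) j' - doubledA g T' (x ∘ ⇑e) (Fin.castAdd a i₀)) 0 : ℝ),
          (doubledA g T' (x ∘ ⇑e) j' - doubledA g T' (x ∘ ⇑e) (Fin.castAdd a i₀)) 1,
          (doubledA g T' (x ∘ ⇑e) j' - doubledA g T' (x ∘ ⇑e) (Fin.castAdd a i₀)) 2) ∈
        Cover.pcut (((g 0 : ℤ) : ℝ), ((g 1 : ℤ) : ℝ), ((g 2 : ℤ) : ℝ)) T P := by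
      intro j'
      rw [hctr]
      induction j' using Fin.addCases with
      | left j =>
        rw [doubledA_left, Function.comp_apply]
        refine Cover.mem_pcut_of_kept (hmem _) ?_
        rw [pdot_cast_pc, rdotZ_sub_pc]
        linarith [hlow j]
      | right j =>
        rw [doubledA_right, Function.comp_apply, toPt_reflectZ_sub_pc g T T' _ _ hT']
        refine Cover.image_mem_pcut (hmem _) ?_
        rw [pdot_cast_pc, rdotZ_sub_pc]
        linarith [hlow j]
    obtain ⟨μ₂, hμ₂, hrec⟩ := ih (a + a) (doubledA g T' (x ∘ ⇑e)) (Fin.castAdd a i₀) hdist' hmem'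
    refine ⟨min m μ₂, lt_min hm hμ₂, fun μ hμ => ?_⟩
    obtain ⟨d, hd⟩ := hrec μ (hμ.trans (min_le_right _ _))
    have hμm : μ ≤ m := hμ.trans (min_le_left _ _)
    refine ⟨d + 1, (pedigreeOK_succ μ d x i).2 (Or.inr ⟨g, T', a, b, e, i₀, hg, hei,
      fun j => ?_, fun j => ?_, hd⟩)⟩
    · have h2 := hgap (e (Fin.castAdd b j))
      rw [abs_of_neg (by linarith [hlow j])] at h2
      linarith [hlow j]
    · have h2 := hgap (e (Fin.natAdd a j))
      rw [abs_of_nonneg (by linarith [hhigh j])] at h2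
      linarith [hhigh j]

/-! ### The stub -/

/-- **Stub `pedigree_cover`** (line `only-interaction-breaks-moebius`, crux `MoebiusLimitExists`).
Granted the combinatorial covering theorem — every finite `P ⊂ ℝ³` has a mirror pedigree with moving
point `0` — every non-coincident configuration `x : Fin n → ℝ³` admits, for every moving index `i`,
a mirror pedigree `PedigreeOK μ d n x i` with some positive margin `μ` and some depth `d`: apply the
transport `cover_main_pc` to the point set `{x j − x i : j}`. [folklore] -/
theorem pedigree_cover :
    (∀ P : Finset (ℝ × ℝ × ℝ),
      Summit.CriticalPhenomena.Ising3DConformalLimit.MoebiusLimitExistsNegative.Pedigree.Cover.HasPedigree P) →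
    ∀ (n : ℕ) (x : Fin n → EuclideanSpace ℝ (Fin 3)), x ∈ NonCoincident 3 n →
      ∀ i : Fin n, ∃ μ > 0, ∃ d : ℕ, PedigreeOK μ d n x i := by
  intro hcov n x hx i
  classical
  have hinj : Function.Injective x := (mem_nonCoincident x).1 hx
  obtain ⟨μ₀, hμ₀, h⟩ := cover_main_pc
    (hcov (Finset.univ.image fun j => (((x j - x i) 0 : ℝ), (x j - x i) 1, (x j - x i) 2)))
    n x i (fun j hj heq => hj (hinj heq)) (fun j => Finset.mem_image_of_mem _ (Finset.mem_univ j))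
  obtain ⟨d, hd⟩ := h μ₀ le_rfl
  exact ⟨μ₀, hμ₀, d, hd⟩

end Summit.CriticalPhenomena.Ising3DConformalLimit.MoebiusLimitExistsOnlyInteraction

end
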